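import Literature.AlgebraicGeometry.HodgeTheory.FermatAokiStandardCharacter
import Literature.AlgebraicGeometry.HodgeTheory.FermatClaimPermutationInvariance
import HarnessLib

/-!
# Aoki's standard characters `σ_{p,a}`, `(a, d) = 1`, are one orbit under `(ℤ/m)ˣ` and the permutations fixing `x_p`

Family `hodge`, layer `Literature/AlgebraicGeometry/HodgeTheory`. PROOF FILE (theorems only; algebra of
the characters, sequel of `FermatAokiStandardCharacter`) for the leaf `Aoki1987_thm_2_1_supportedClass`
of `Aoki1987_claim_pStandard` — N. Aoki, J. Math. Soc. Japan 39 (1987), §1 (p. 387: the standard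
elements `σ_{p,i}`), Thm. 2-1 (p. 388: `σ = (a, a+d, …, a+(p-1)d, -pa)`, `(a, d) = 1`).

For `p = 2r + 1` prime, `p ∣ m`, `d = m/p` and `a ∈ ℤ/m` with `(⟨a⟩, d) = 1`:

* `FermatCharacter.exists_unit_eq_add_mul` — `a = t + ℓd` for a unit `t ∈ (ℤ/m)ˣ` (one of `a`,
  `a + d` is prime to `p` too);
* `FermatCharacter.univ_val_map_aokiStandard_castSucc_eq` — the first `p` coordinates
  `{a + kd}_{k<p}` of `σ_{p,a}` and `{t(1 + kd)}_{k<p}` of `t·σ_{p,1}` are the same multiset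
  (`k ↦ ℓ + k`, `k ↦ tk` permute `ℤ/p`, and `(k mod p)·d = k·d` in `ℤ/m`);
* **`FermatCharacter.exists_aokiStandard_eq_unit_mul_one_comp`** — hence
  `σ_{p,a} = (t·σ_{p,1}) ∘ π` for a unit `t` and a permutation `π` of the `p + 1` coordinates FIXING
  THE LAST ONE (the last coordinates are `-pa = -pt` as `pd = m`).

Consumed by `FermatAokiRepresentsAllFromOne` ("`Y` represents `σ_{p,1}`" gives Thm. 2-1 for every `a`).

## References

* [Aoki1987] N. Aoki, Some new algebraic cycles on Fermat varieties, J. Math. Soc. Japan 39 (1987)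
  385–396, §1 (p. 387), Thm. 2-1 (p. 388).
-/

noncomputable section

open Finset

namespace Literature.AlgebraicGeometry.HodgeTheory

namespace FermatCharacter

/-! ### Arithmetic in `ℤ/m`, `m = pd` -/

/-- `(x mod p)·d = x·d` in `ℤ/m` when `m = pd`. [folklore] -/
theorem natCast_mod_mul_eq {m p d : ℕ} (hm : p * d = m) (x : ℕ) :
    ((x % p : ℕ) : ZMod m) * (d : ZMod m) = (x : ZMod m) * (d : ZMod m) := by
  conv_rhs => rw [← Nat.div_add_mod x p]
  have h0 : ((p : ZMod m)) * (d : ZMod m) = 0 := by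
    rw [← Nat.cast_mul, hm, ZMod.natCast_self]
  push_cast
  rw [add_mul, mul_comm (p : ZMod m) ((x / p : ℕ) : ZMod m), mul_assoc, h0, mul_zero, zero_add]

/-- **A residue `a ∈ ℤ/m` prime to `d = m/p` is `t + ℓd` for a unit `t ∈ (ℤ/m)ˣ`** (`p` prime,
`m = pd`): one of `a`, `a + d` is prime to `p` as well as to `d`. [folklore] -/
theorem exists_unit_eq_add_mul {m p d : ℕ} [NeZero m] (hp : p.Prime) (hm : p * d = m) {a : ZMod m}
    (ha : Nat.Coprime a.val d) :
    ∃ t : (ZMod m)ˣ, ∃ ℓ : ZMod m, a = (t : ZMod m) + ℓ * (d : ZMod m) := by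
  -- some `a.val + j d` is prime to `m`
  obtain ⟨j, hj⟩ : ∃ j : ℕ, Nat.Coprime (a.val + j * d) m := by
    by_cases hpa : p ∣ a.val
    · refine ⟨1, ?_⟩
      have h : Nat.Coprime (a.val + 1 * d) (p * d) := by
        rw [one_mul]
        refine Nat.Coprime.mul_right ?_ ?_
        · rw [Nat.coprime_comm, Nat.Prime.coprime_iff_not_dvd hp]
          intro h
          have hpd : p ∣ d := (Nat.dvd_add_right hpa).mp h
          have h1 : p ∣ Nat.gcd a.val d := Nat.dvd_gcd hpa hpd
          rw [ha] at h1
          exact hp.one_lt.ne' (Nat.dvd_one.mp h1)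
        · simpa using (Nat.coprime_add_mul_right_left a.val d 1).mpr ha
      rwa [hm] at h
    · refine ⟨0, ?_⟩
      have h : Nat.Coprime (a.val + 0 * d) (p * d) := by
        rw [zero_mul, add_zero]
        exact Nat.Coprime.mul_right (Nat.coprime_comm.mp ((Nat.Prime.coprime_iff_not_dvd hp).mpr hpa)) ha
      rwa [hm] at h
  refine ⟨ZMod.unitOfCoprime _ hj, -(j : ZMod m), ?_⟩
  rw [ZMod.coe_unitOfCoprime, Nat.cast_add, Nat.cast_mul, ZMod.natCast_zmod_val]
  ring

/-! ### The first `p` coordinates of `σ_{p,a}` and of `t·σ_{p,1}` -/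

variable {r m : ℕ}

/-- The multiset `{t + k·d : k < p}` is invariant under `k ↦ ℓ + k`: the first `p` coordinates of
`σ_{p,t+ℓd}` and of `σ_{p,t}` agree as multisets. [cite: Aoki1987, §1 (p. 387)] -/
theorem univ_val_map_add_mul_eq [NeZero m] (hpm : 2 * r + 1 ∣ m) (t ℓ : ZMod m) :
    (univ : Finset (Fin (2 * r + 1))).val.map
        (fun i : Fin (2 * r + 1) ↦ t + (ℓ + ((i : ℕ) : ZMod m)) * ((m / (2 * r + 1) : ℕ) : ZMod m)) =
      (univ : Finset (Fin (2 * r + 1))).val.map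
        (fun i : Fin (2 * r + 1) ↦ t + ((i : ℕ) : ZMod m) * ((m / (2 * r + 1) : ℕ) : ZMod m)) := by
  set D : ZMod m := ((m / (2 * r + 1) : ℕ) : ZMod m) with hD
  have hm : (2 * r + 1) * (m / (2 * r + 1)) = m := Nat.mul_div_cancel' hpm
  let e : Equiv.Perm (Fin (2 * r + 1)) := Equiv.addLeft (Fin.ofNat (2 * r + 1) ℓ.val)
  have key : (fun i : Fin (2 * r + 1) ↦ t + (ℓ + ((i : ℕ) : ZMod m)) * D) =
      (fun i : Fin (2 * r + 1) ↦ t + ((i : ℕ) : ZMod m) * D) ∘ e := by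
    funext i
    have hval : ((e i : Fin (2 * r + 1)) : ℕ) = (ℓ.val % (2 * r + 1) + (i : ℕ)) % (2 * r + 1) := by
      simp [e, Fin.val_add]
    rw [Function.comp_apply, hval, natCast_mod_mul_eq hm, Nat.cast_add, add_mul, add_mul,
      natCast_mod_mul_eq hm, ZMod.natCast_zmod_val]
  rw [key, ← Multiset.map_map, Multiset.map_univ_val_equiv]

/-- The multiset `{t + k·d : k < p}` is invariant under `k ↦ t k` for a unit `t`: the first `p`
coordinates of `t·σ_{p,1}` and of `σ_{p,t}` agree as multisets. [cite: Aoki1987, §1 (p. 387)] -/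
theorem univ_val_map_unit_mul_eq [NeZero m] (hpm : 2 * r + 1 ∣ m) (t : (ZMod m)ˣ) :
    (univ : Finset (Fin (2 * r + 1))).val.map
        (fun i : Fin (2 * r + 1) ↦
          (t : ZMod m) + (t : ZMod m) * ((i : ℕ) : ZMod m) * ((m / (2 * r + 1) : ℕ) : ZMod m)) =
      (univ : Finset (Fin (2 * r + 1))).val.map
        (fun i : Fin (2 * r + 1) ↦ (t : ZMod m) + ((i : ℕ) : ZMod m) * ((m / (2 * r + 1) : ℕ) : ZMod m)) := by
  set D : ZMod m := ((m / (2 * r + 1) : ℕ) : ZMod m) with hD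
  have hm : (2 * r + 1) * (m / (2 * r + 1)) = m := Nat.mul_div_cancel' hpm
  -- `t` is a unit modulo `p = 2r + 1`
  have hcop : Nat.Coprime (t : ZMod m).val (2 * r + 1) :=
    Nat.Coprime.coprime_dvd_right hpm (ZMod.val_coe_unit_coprime t)
  let u : (ZMod (2 * r + 1))ˣ := ZMod.unitOfCoprime _ hcop
  let e : Equiv.Perm (Fin (2 * r + 1)) := (Units.mulLeft u : Equiv.Perm (ZMod (2 * r + 1)))
  have key : (fun i : Fin (2 * r + 1) ↦ (t : ZMod m) + (t : ZMod m) * ((i : ℕ) : ZMod m) * D) =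
      (fun i : Fin (2 * r + 1) ↦ (t : ZMod m) + ((i : ℕ) : ZMod m) * D) ∘ e := by
    funext i
    have hval : ((e i : Fin (2 * r + 1)) : ℕ) = ((t : ZMod m).val * (i : ℕ)) % (2 * r + 1) := by
      change ZMod.val ((u : ZMod (2 * r + 1)) * (show ZMod (2 * r + 1) from i)) = _
      rw [ZMod.val_mul, ZMod.coe_unitOfCoprime, ZMod.val_natCast, Nat.mod_mul_mod]
      rfl
    rw [Function.comp_apply, hval, natCast_mod_mul_eq hm, Nat.cast_mul, ZMod.natCast_zmod_val, mul_assoc]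
  rw [key, ← Multiset.map_map, Multiset.map_univ_val_equiv]

/-- **The first `p` coordinates of `σ_{p,a}` and of `t·σ_{p,1}` are the same multiset** when
`a = t + ℓd`, `t ∈ (ℤ/m)ˣ`. [cite: Aoki1987, §1 (p. 387) and Thm. 2-1 (p. 388)] -/
theorem univ_val_map_aokiStandard_castSucc_eq [NeZero m] (hpm : 2 * r + 1 ∣ m) {a : ZMod m}
    {t : (ZMod m)ˣ} {ℓ : ZMod m} (hat : a = (t : ZMod m) + ℓ * ((m / (2 * r + 1) : ℕ) : ZMod m)) :
    (univ : Finset (Fin (2 * r + 1))).val.map (fun i : Fin (2 * r + 1) ↦ aokiStandard r m a (Fin.castSucc i)) =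
      (univ : Finset (Fin (2 * r + 1))).val.map
        (fun i : Fin (2 * r + 1) ↦ (t : ZMod m) * aokiStandard r m 1 (Fin.castSucc i)) := by
  have h1 : (fun i : Fin (2 * r + 1) ↦ aokiStandard r m a (Fin.castSucc i)) =
      fun i : Fin (2 * r + 1) ↦ (t : ZMod m) + (ℓ + ((i : ℕ) : ZMod m)) * ((m / (2 * r + 1) : ℕ) : ZMod m) := by
    funext i; rw [aokiStandard_castSucc, hat]; ring
  have h2 : (fun i : Fin (2 * r + 1) ↦ (t : ZMod m) * aokiStandard r m 1 (Fin.castSucc i)) =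
      fun i : Fin (2 * r + 1) ↦
        (t : ZMod m) + (t : ZMod m) * ((i : ℕ) : ZMod m) * ((m / (2 * r + 1) : ℕ) : ZMod m) := by
    funext i; rw [aokiStandard_castSucc]; ring
  rw [h1, h2, univ_val_map_add_mul_eq hpm, univ_val_map_unit_mul_eq hpm]

/-- **`σ_{p,a} = (t·σ_{p,1}) ∘ π` for a permutation `π` of the coordinates fixing `x_p`**, whenever
`a = t + ℓd` with `t ∈ (ℤ/m)ˣ` (`p = 2r + 1 ∣ m`, `d = m/p`): the first `p` coordinates agree as
multisets and the last ones are `-pa = -pt` (`pd = m`). [cite: Aoki1987, §1 (p. 387) and Thm. 2-1 (p. 388)] -/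
theorem exists_aokiStandard_eq_unit_mul_comp_perm [NeZero m] (hpm : 2 * r + 1 ∣ m) {a : ZMod m}
    {t : (ZMod m)ˣ} {ℓ : ZMod m} (hat : a = (t : ZMod m) + ℓ * ((m / (2 * r + 1) : ℕ) : ZMod m)) :
    ∃ π : Equiv.Perm (Fin (2 * r + 2)), π (Fin.last (2 * r + 1)) = Fin.last (2 * r + 1) ∧
      aokiStandard r m a = (fun i ↦ (t : ZMod m) * aokiStandard r m 1 i) ∘ π := by
  classical
  obtain ⟨π, hπ⟩ := exists_perm_eq_comp_of_univ_val_map_eq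
    (univ_val_map_aokiStandard_castSucc_eq hpm hat).symm
  -- extend `π` by `x_p ↦ x_p`
  let L : Equiv.Perm (Fin (2 * r + 2)) :=
    { toFun := fun i ↦ Fin.lastCases (Fin.last (2 * r + 1)) (fun j ↦ Fin.castSucc (π j)) i
      invFun := fun i ↦ Fin.lastCases (Fin.last (2 * r + 1)) (fun j ↦ Fin.castSucc (π.symm j)) i
      left_inv := fun i ↦ by
        induction i using Fin.lastCases with
        | last => simp
        | cast j => simp
      right_inv := fun i ↦ by
        induction i using Fin.lastCases with
        | last => simp
        | cast j => simp }
  have hLlast : L (Fin.last (2 * r + 1)) = Fin.last (2 * r + 1) := by simp [L]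
  have hLcast : ∀ j, L (Fin.castSucc j) = Fin.castSucc (π j) := fun j ↦ by simp [L]
  refine ⟨L, hLlast, funext fun i ↦ ?_⟩
  induction i using Fin.lastCases with
  | last =>
    rw [Function.comp_apply, hLlast, aokiStandard_last, aokiStandard_last, hat, mul_one]
    have h0 : ((2 * r + 1 : ℕ) : ZMod m) * ((m / (2 * r + 1) : ℕ) : ZMod m) = 0 := by
      rw [← Nat.cast_mul, Nat.mul_div_cancel' hpm, ZMod.natCast_self]
    have : ((2 * r + 1 : ℕ) : ZMod m) * (ℓ * ((m / (2 * r + 1) : ℕ) : ZMod m)) = 0 := by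
      rw [mul_left_comm, h0, mul_zero]
    rw [mul_add, this, add_zero, mul_comm]
    ring
  | cast j =>
    have hj := congrFun hπ j
    simp only [Function.comp_apply] at hj
    rw [Function.comp_apply, hLcast, hj]

/-- **Every `σ_{p,a}` with `(⟨a⟩, d) = 1` is `(t·σ_{p,1}) ∘ π`** for some unit `t ∈ (ℤ/m)ˣ` and some
permutation `π` of the first `p` coordinates (`p = 2r + 1` prime, `p ∣ m`, `d = m/p`).
[cite: Aoki1987, §1 (p. 387: the standard elements) and Thm. 2-1 (p. 388)] -/
theorem exists_aokiStandard_eq_unit_mul_one_comp [NeZero m] (hp : (2 * r + 1).Prime) (hpm : 2 * r + 1 ∣ m)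
    {a : ZMod m} (ha : Nat.Coprime a.val (m / (2 * r + 1))) :
    ∃ (t : (ZMod m)ˣ) (π : Equiv.Perm (Fin (2 * r + 2))), π (Fin.last (2 * r + 1)) = Fin.last (2 * r + 1) ∧
      aokiStandard r m a = (fun i ↦ (t : ZMod m) * aokiStandard r m 1 i) ∘ π := by
  obtain ⟨t, ℓ, hat⟩ := exists_unit_eq_add_mul hp (Nat.mul_div_cancel' hpm) ha
  obtain ⟨π, hπ, h⟩ := exists_aokiStandard_eq_unit_mul_comp_perm hpm hat
  exact ⟨t, π, hπ, h⟩

end FermatCharacter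

end Literature.AlgebraicGeometry.HodgeTheory

end
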